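import Mathlib.Analysis.Calculus.Deriv.Inv
import Mathlib.Topology.LocallyConstant.Basic
import Literature.Geometry.Symplectic.JHolomorphicMap
import Literature.Geometry.Symplectic.PlanarExactDensityDecay
import Literature.Geometry.Kaehler.ManifoldFormsPullback
import HarnessLib

/-!
# Exact tame almost complex manifolds contain no `J`-holomorphic spheres

Topic `Literature/Geometry/Symplectic`.  The energy argument of Gromov's theory of
pseudo-holomorphic curves in its most elementary instance (McDuff–Salamon, *Introduction to
Symplectic Topology*, 3rd ed. (2017), §4.5, energy identity (4.5.4)
`E(u) = ½ ∫ |du|² = ∫ u^*ω` for `J`-holomorphic `u` and `ω`-tame `J`): if the taming form is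
EXACT, `ω = dλ`, a `J`-holomorphic sphere has energy `∫_{S²} u^*dλ = ∫_{S²} d(u^*λ) = 0`, hence
is constant.  In the language of Eliashberg (1990), §1.5, an almost complex manifold `(M, J)`
tamed by an exact symplectic form is *holomorphically aspherical*; this is one of the three
hypotheses of Eliashberg's Theorem 5.1 (a holomorphically aspherical domain with smooth
`J`-convex boundary diffeomorphic to `S³` in a tame almost complex manifold is diffeomorphic to
`B⁴`), and the file `SteinFillingSphereProofs.lean` specialises it to the tree's Stein domains.

## The statement proved (`jSphere_const_of_exact_tame`)

Let `M` be a `C^∞` real manifold (any model with corners `I`), `λ` a smooth `1`-form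
(`Literature.Geometry.Kaehler.IsSmoothForm`), `J` a field of endomorphisms of the tangent spaces
with `dλ(e, J e) > 0` for `e ≠ 0` (`dλ = Literature.Geometry.Kaehler.mextDeriv λ` tames `J`), and
let `u, v : ℂ → M` be `C^∞` with `v z = u z⁻¹` for `z ≠ 0` — i.e. `u` and `v` are the two affine
charts of a `C^∞` map `ℂP¹ = ℂ ∪_{z ↦ 1/z} ℂ → M` — with `u` `J`-holomorphic
(`Literature.Geometry.Symplectic.IsJHolomorphic`: `du ∘ i = J ∘ du`).  Then `u` is constant.

## Proof (chart level, no integration on manifolds needed)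

* `β = u^*λ` is a `C^∞` `1`-form on `ℂ` with `dβ = u^*dλ` (the tree's pull-back calculus
  `MForm.SmoothAt.pullback`, `mextDeriv_pullback_apply`, `mextDeriv_eq_extDeriv`), and
  `dβ(1, i) = dλ(u_x, u_y) = dλ(u_x, J u_x) ≥ 0`, with equality only where `u_x = 0`;
* near `∞`, `u = v ∘ (z ↦ 1/z)`, so `|β_z(w)| ≤ C ‖w‖ / ‖z‖²` for `‖z‖ ≥ 1`
  (`C = max_{‖w‖ ≤ 1} ‖(v^*λ)_w‖`);
* Stokes on `ℂ` with a cut-off `χ_R(z) = χ(z/R)` (`∫_ℂ d(χ_R β)(1, i) = 0`, the tree's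
  `Literature.Geometry.GeometricMeasureTheory.integral_extDeriv_apply_eq_zero`):
  `∫_{‖z‖ ≤ r} dβ(1,i) ≤ ∫ χ_R dβ(1,i) = -∫ (dχ_R ∧ β)(1,i) = O(1/R)`, so the non-negative
  continuous function `dβ(1, i)` vanishes identically
  (`extDeriv_apply_eq_zero_of_nonneg_of_decay` of `PlanarExactDensityDecay.lean`);
* hence `u_x = 0`, `u_y = J u_x = 0`, `du = 0`, and `u` is locally constant (charts), so constant.

## References

* D. McDuff, D. Salamon, *Introduction to Symplectic Topology*, 3rd ed., OUP (2017), §4.5,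
  eq. (4.5.4) and Remark 4.5.2 (ii) (energy identity; exactness arguments). [McDuffSalamon2017]
* Ya. Eliashberg, *Filling by holomorphic discs and its applications*, LMS Lecture Note Ser. 151
  (1990), §1.5 (tame; holomorphically aspherical), Thm. 5.1. [Eliashberg1990]
-/

noncomputable section

open scoped Manifold ContDiff Topology
open Set Filter Metric

namespace Literature.Geometry.Symplectic

open Literature.Geometry.Kaehler


/-! ### Forms pulled back along maps `ℂ → M` -/

section Pullback

variable {E : Type*} [NormedAddCommGroup E] [NormedSpace ℝ E] {H : Type*} [TopologicalSpace H]
  {I : ModelWithCorners ℝ E H} {M : Type*} [TopologicalSpace M] [ChartedSpace H M]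

/-- On `ℂ` charted by itself the chart representative of a form is the form itself. [folklore] -/
theorem inChart_self_eq {k : ℕ} (β : MForm 𝓘(ℝ, ℂ) ℂ ℝ k) (z : ℂ) : β.inChart z = β := by
  funext y
  ext v
  simp [MForm.inChart_apply]
  rfl

/-- On `ℂ` charted by itself, chart-wise smoothness of a form at a point is `ContDiffAt`.
[folklore] -/
theorem contDiffAt_of_smoothAt {k : ℕ} {β : MForm 𝓘(ℝ, ℂ) ℂ ℝ k} {z : ℂ} (h : β.SmoothAt z) :
    ContDiffAt ℝ (F := ℂ [⋀^Fin k]→L[ℝ] ℝ) ∞ β z := by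
  have h' : ContDiffWithinAt ℝ ∞ (β.inChart z) (range 𝓘(ℝ, ℂ)) (extChartAt 𝓘(ℝ, ℂ) z z) := h
  rw [inChart_self_eq] at h'
  simpa [contDiffWithinAt_univ] using h'

variable [IsManifold I ∞ M]

/-- **The pull-back of a smooth form along a `C^∞` map `ℂ → M` is a `C^∞` form on `ℂ`**
(Warner 2.22, via the tree's `MForm.SmoothAt.pullback`). [folklore] -/
theorem contDiff_pullback_of_contMDiff {k : ℕ} {lam : MForm I M ℝ k} (hlam : IsSmoothForm lam)
    {u : ℂ → M} (hu : ContMDiff 𝓘(ℝ, ℂ) I ∞ u) :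
    ContDiff ℝ (F := ℂ [⋀^Fin k]→L[ℝ] ℝ) ∞ (lam.pullback 𝓘(ℝ, ℂ) u) :=
  contDiff_iff_contDiffAt.2 fun z =>
    contDiffAt_of_smoothAt (MForm.SmoothAt.pullback (I := 𝓘(ℝ, ℂ)) (I' := I)
      (Eventually.of_forall fun w => hu w) ((isSmoothForm_iff_smoothAt lam).1 hlam (u z)))

/-- **`d(u^*λ) = u^*(dλ)` on `ℂ`**, evaluated: for a smooth `1`-form `λ` on `M` and a `C^∞` map
`u : ℂ → M`, `d(u^*λ)_z(v₀, v₁) = (dλ)_{u z}(du_z v₀, du_z v₁)` (Warner, Prop. 2.23, via the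
tree's `mextDeriv_pullback_apply` and `mextDeriv_eq_extDeriv`). [folklore] -/
theorem extDeriv_pullback_apply_eq {lam : MForm I M ℝ 1} (hlam : IsSmoothForm lam) {u : ℂ → M}
    (hu : ContMDiff 𝓘(ℝ, ℂ) I ∞ u) (z : ℂ) (v : Fin 2 → ℂ) :
    extDeriv (lam.pullback 𝓘(ℝ, ℂ) u) z v =
      mextDeriv lam (u z) (fun i => mfderiv 𝓘(ℝ, ℂ) I u z (v i)) := by
  have h := mextDeriv_pullback_apply (I := 𝓘(ℝ, ℂ)) (I' := I) (f := u) (β := lam) (x := z)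
    (Eventually.of_forall fun w => hu w) ((isSmoothForm_iff_smoothAt lam).1 hlam (u z))
  rw [← mextDeriv_eq_extDeriv, h]
  rfl

/-! ### `J`-holomorphic maps with vanishing `∂u/∂x`; maps with vanishing differential -/

omit [IsManifold I ∞ M] in
/-- For a `J`-holomorphic `u : ℂ → M`, `du_z(1) = 0` forces `du_z = 0`
(`du_z(i) = J du_z(1)` and `du_z` is real linear). [folklore] -/
theorem mfderiv_eq_zero_of_apply_one_eq_zero
    {J : ∀ x : M, TangentSpace I x →L[ℝ] TangentSpace I x} {u : ℂ → M}
    (hJ : IsJHolomorphic I J u) {z : ℂ} (h : mfderiv 𝓘(ℝ, ℂ) I u z (1 : ℂ) = 0) :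
    mfderiv 𝓘(ℝ, ℂ) I u z = 0 := by
  have hI : mfderiv 𝓘(ℝ, ℂ) I u z Complex.I = 0 := by
    have h' := hJ z 1
    rw [mul_one] at h'
    rw [h', h, map_zero]
  exact clm_eq_zero_of_apply_one_of_apply_I (F := E) (mfderiv 𝓘(ℝ, ℂ) I u z) h hI

/-- **A `C¹` map `ℂ → M` with identically vanishing differential is constant**: in a chart it
has zero Fréchet derivative on a ball, hence is locally constant, and `ℂ` is connected.
[folklore] -/
theorem apply_eq_apply_zero_of_mfderiv_eq_zero {u : ℂ → M} (hu : ContMDiff 𝓘(ℝ, ℂ) I 1 u)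
    (h : ∀ z, mfderiv 𝓘(ℝ, ℂ) I u z = 0) (z : ℂ) : u z = u 0 := by
  have hloc : IsLocallyConstant u := by
    refine (IsLocallyConstant.iff_eventually_eq u).2 fun z₀ => ?_
    have hsrc : ∀ᶠ w in 𝓝 z₀, u w ∈ (chartAt H (u z₀)).source :=
      hu.continuous.continuousAt.preimage_mem_nhds
        ((chartAt H (u z₀)).open_source.mem_nhds (mem_chart_source H (u z₀)))
    obtain ⟨ε, hε, hball⟩ := Metric.eventually_nhds_iff_ball.1 hsrc
    have hg : ∀ w ∈ ball z₀ ε,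
        HasFDerivAt (fun w => extChartAt I (u z₀) (u w)) (0 : ℂ →L[ℝ] E) w := by
      intro w hw
      have h1 : HasMFDerivAt 𝓘(ℝ, ℂ) I u w (mfderiv 𝓘(ℝ, ℂ) I u w) :=
        ((hu w).mdifferentiableAt one_ne_zero).hasMFDerivAt
      have h2 := (hasMFDerivAt_extChartAt (I := I) (hball w hw)).comp w h1
      rw [h, ContinuousLinearMap.comp_zero] at h2
      exact hasMFDerivAt_iff_hasFDerivAt.1 h2
    have hconst : ∀ w ∈ ball z₀ ε, extChartAt I (u z₀) (u w) = extChartAt I (u z₀) (u z₀) :=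
      fun w hw => isOpen_ball.is_const_of_fderiv_eq_zero (convex_ball z₀ ε).isPreconnected
        (fun w hw => (hg w hw).differentiableAt.differentiableWithinAt)
        (fun w hw => (hg w hw).fderiv) hw (mem_ball_self hε)
    filter_upwards [ball_mem_nhds z₀ hε] with w hw
    refine (extChartAt I (u z₀)).injOn ?_ ?_ (hconst w hw)
    · rw [extChartAt_source]; exact hball w hw
    · rw [extChartAt_source]; exact hball z₀ (mem_ball_self hε)
  exact hloc.apply_eq_of_preconnectedSpace z 0

/-! ### The theorem -/

/-- **An exact tame almost complex manifold contains no `J`-holomorphic sphere** (the energy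
identity, McDuff–Salamon (2017), §4.5, (4.5.4), for an exact taming form; Eliashberg (1990),
§1.5: such `(M, J)` is *holomorphically aspherical*).  Let `λ` be a smooth `1`-form on the `C^∞`
manifold `M` and `J` a field of tangent-space endomorphisms with `dλ(e, J e) > 0` for `e ≠ 0`.
If `u, v : ℂ → M` are `C^∞`, `v z = u z⁻¹` for `z ≠ 0` (the two affine charts of a `C^∞` map
`ℂP¹ → M`) and `u` is `J`-holomorphic, then `u` is constant.
[cite: McDuffSalamon2017, §4.5 eq. (4.5.4)] -/
theorem jSphere_const_of_exact_tame {lam : MForm I M ℝ 1} (hlam : IsSmoothForm lam)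
    {J : ∀ x : M, TangentSpace I x →L[ℝ] TangentSpace I x}
    (htame : ∀ (x : M) (e : TangentSpace I x), e ≠ 0 → 0 < mextDeriv lam x ![e, J x e])
    {u v : ℂ → M} (hu : ContMDiff 𝓘(ℝ, ℂ) I ∞ u) (hv : ContMDiff 𝓘(ℝ, ℂ) I ∞ v)
    (huv : ∀ z : ℂ, z ≠ 0 → v z = u z⁻¹) (hJ : IsJHolomorphic I J u) (z : ℂ) : u z = u 0 := by
  set β : ℂ → ℂ [⋀^Fin 1]→L[ℝ] ℝ := lam.pullback 𝓘(ℝ, ℂ) u with hβdef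
  set γ : ℂ → ℂ [⋀^Fin 1]→L[ℝ] ℝ := lam.pullback 𝓘(ℝ, ℂ) v with hγdef
  have hβ : ContDiff ℝ ∞ β := contDiff_pullback_of_contMDiff hlam hu
  have hγ : ContDiff ℝ ∞ γ := contDiff_pullback_of_contMDiff hlam hv
  -- `‖(v^*λ)_w‖ ≤ Cγ` on the unit disc
  obtain ⟨Cγ, hCγ⟩ : ∃ Cγ, ∀ w ∈ closedBall (0 : ℂ) 1, ‖γ w‖ ≤ Cγ :=
    (isCompact_closedBall (0 : ℂ) 1).exists_bound_of_continuousOn hγ.continuous.continuousOn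
  -- quadratic decay of `β = u^*λ` at infinity, through the chart `z ↦ 1/z`
  have hdecay : ∀ z : ℂ, 1 ≤ ‖z‖ → ∀ w : ℂ, |β z ![w]| ≤ Cγ * ‖w‖ / ‖z‖ ^ 2 := by
    intro z hz w
    have hz0 : z ≠ 0 := by
      rintro rfl
      norm_num at hz
    have huz : u z = v z⁻¹ := by rw [huv z⁻¹ (inv_ne_zero hz0), inv_inv]
    have hev : u =ᶠ[𝓝 z] (v ∘ fun w : ℂ => w⁻¹) := by
      filter_upwards [isOpen_ne.mem_nhds hz0] with w hw
      simp only [Function.comp_apply]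
      rw [huv w⁻¹ (inv_ne_zero hw), inv_inv]
    have hdinv : HasFDerivAt (fun w : ℂ => w⁻¹)
        ((ContinuousLinearMap.smulRight (1 : ℂ →L[ℂ] ℂ) (-(z ^ 2)⁻¹)).restrictScalars ℝ) z :=
      (hasDerivAt_inv hz0).hasFDerivAt.restrictScalars ℝ
    have hmf : mfderiv 𝓘(ℝ, ℂ) I u z = (mfderiv 𝓘(ℝ, ℂ) I v z⁻¹).comp
        ((ContinuousLinearMap.smulRight (1 : ℂ →L[ℂ] ℂ) (-(z ^ 2)⁻¹)).restrictScalars ℝ) := by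
      rw [hev.mfderiv_eq, mfderiv_comp z ((hv z⁻¹).mdifferentiableAt (by simp))
        hdinv.differentiableAt.mdifferentiableAt, mfderiv_eq_fderiv, hdinv.fderiv]
      rfl
    have hβz : β z ![w] = γ z⁻¹ ![-(z ^ 2)⁻¹ * w] := by
      have e1 : β z ![w] = lam (u z) (fun i => mfderiv 𝓘(ℝ, ℂ) I u z (![w] i)) := rfl
      have e2 : γ z⁻¹ ![-(z ^ 2)⁻¹ * w] =
          lam (v z⁻¹) (fun i => mfderiv 𝓘(ℝ, ℂ) I v z⁻¹ (![-(z ^ 2)⁻¹ * w] i)) := rfl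
      rw [e1, e2, hmf, huz]
      congr 1
      funext i
      fin_cases i
      show (mfderiv 𝓘(ℝ, ℂ) I v z⁻¹) (w * -(z ^ 2)⁻¹) = (mfderiv 𝓘(ℝ, ℂ) I v z⁻¹) (-(z ^ 2)⁻¹ * w)
      rw [mul_comm]
    rw [hβz]
    have hzinv : z⁻¹ ∈ closedBall (0 : ℂ) 1 := by
      rw [mem_closedBall_zero_iff, norm_inv]
      exact inv_le_one_of_one_le₀ hz
    calc |γ z⁻¹ ![-(z ^ 2)⁻¹ * w]| = ‖γ z⁻¹ ![-(z ^ 2)⁻¹ * w]‖ := rfl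
      _ ≤ ‖γ z⁻¹‖ * ∏ i, ‖![-(z ^ 2)⁻¹ * w] i‖ := ContinuousAlternatingMap.le_opNorm _ _
      _ = ‖γ z⁻¹‖ * (‖w‖ / ‖z‖ ^ 2) := by
          simp [norm_inv, norm_pow, div_eq_inv_mul]
      _ ≤ Cγ * (‖w‖ / ‖z‖ ^ 2) := by gcongr; exact hCγ _ hzinv
      _ = Cγ * ‖w‖ / ‖z‖ ^ 2 := by ring
  -- the energy density `d(u^*λ)(1, i) = dλ(u_x, J u_x)` and its sign
  have hFeq : ∀ z, extDeriv β z ![1, Complex.I] = mextDeriv lam (u z)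
      ![mfderiv 𝓘(ℝ, ℂ) I u z (1 : ℂ), J (u z) (mfderiv 𝓘(ℝ, ℂ) I u z (1 : ℂ))] := by
    intro z
    rw [hβdef, extDeriv_pullback_apply_eq hlam hu]
    have hI : mfderiv 𝓘(ℝ, ℂ) I u z Complex.I = J (u z) (mfderiv 𝓘(ℝ, ℂ) I u z (1 : ℂ)) := by
      simpa using hJ z 1
    congr 1
    funext i
    fin_cases i <;> simp [hI]
  have hF : ∀ z, 0 ≤ extDeriv β z ![1, Complex.I] := by
    intro z
    rw [hFeq]
    by_cases he : mfderiv 𝓘(ℝ, ℂ) I u z (1 : ℂ) = 0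
    · rw [he, map_zero]
      exact le_of_eq ((mextDeriv lam (u z)).map_coord_zero (0 : Fin 2) rfl).symm
    · exact (htame _ _ he).le
  -- so the energy density vanishes identically, hence `du = 0` everywhere
  have hF0 := extDeriv_apply_eq_zero_of_nonneg_of_decay hβ hdecay hF
  have hdu : ∀ z, mfderiv 𝓘(ℝ, ℂ) I u z = 0 := by
    intro z
    apply mfderiv_eq_zero_of_apply_one_eq_zero hJ
    by_contra he
    have hpos := htame _ _ he
    rw [← hFeq, hF0 z] at hpos
    exact lt_irrefl _ hpos
  exact apply_eq_apply_zero_of_mfderiv_eq_zero (hu.of_le (by exact_mod_cast le_top)) hdu z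

end Pullback

end Literature.Geometry.Symplectic
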